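import Mathlib
import Literature.NumberTheory.LFunctions.Zhang2022.SkeletonMeanValue
import Literature.NumberTheory.LFunctions.Zhang2022.DetectorMainTermForm
import HarnessLib

/-!
# Zhang (2022), typed skeleton — detector TEMPLATE: the §2 discrete mean, Lemma 2.3, (2.16),
# Lemma 8.1 and Proposition 7.1 with the zero-detector `𝔠*(ρ,ψ)ω(ρ)` replaced by a PARAMETER

Topic `Literature/NumberTheory/LFunctions/Zhang2022` (Landau–Siegel audit tree; verdict-neutral).
Y. Zhang, *Discrete mean estimates and the Landau–Siegel zero*, arXiv:2211.02515v1 (2022)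
[Zhang2022LandauSiegel] — **an unrefereed manuscript under adjudication; nothing in this file
asserts or denies any of its claims, and nothing here is a claim about Landau–Siegel zeros.**

Purpose (LANDAU–SIEGEL PROGRAMME, cell `landau-siegel`, design family B-det = "alternative
zero-detectors for the §2 endgame re-using §§3–17 as typed"). The manuscript's §2 endgame rests on
ONE zero-detector: the discrete means `Σ_{ψ∈Ψ₁} Σ_{ρ∈𝔷(ψ)} 𝔠*(ρ,ψ)·(…)·ω(ρ)` over the sampled zeros
(2.14) with the residue weight `𝔠*(ρ,ψ) = −iM(ρ+β₁)M(ρ+β₂)M(ρ+β₃)/M′(ρ)` (§2 p. 5), its sign lemma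
(Lemma 2.3: `𝔠* ≥ 0`, whence (2.16) `ΣΣ𝔠*|𝔥|²ω ≥ 0`), the residue step Lemma 8.1 (discrete mean ↦
the contour integral `Θ₁` with kernel `𝔠(s,ψ)` of (7.1)) and the mean-value formula Proposition 7.1
(`Θ₁ = α⁻¹(½S₁ + 2S₂ + 3/2S₃)𝔓 + O(E) + o(𝔓)`). The typed skeleton (`SkeletonObjects`,
`SkeletonPropositions`, `SkeletonMeanValue`) states these nodes for THAT detector only
(`Skeleton.idx`, `Skeleton.cstar`, `Skeleton.lhs81`, `Skeleton.Lemma23`, `Skeleton.Lemma81`,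
`Skeleton.Theta1`, `Skeleton.Prop71`). A B-det DESIGN replaces the detector; its named estimates
E(d) are the SAME four nodes with the detector as a parameter. This file supplies exactly that,
as DEFINITIONS with parameters (no new claim is introduced; every `Prop` below is a predicate ON a
design, to be cited by a design's E(d) row, never asserted):

| decl | generalises | content |
|---|---|---|
| `Detector` | `Ψ₁`, `𝔷(ψ)`, `𝔠*ω` | a design datum: sub-family `fam`, sampled points `pts`, weight `wt` |
| `Detector.idx`, `Detector.mean`, `Detector.pairMean` | `Skeleton.idx`, `Ξ…`, `Skeleton.lhs81` | the index finset and the discrete means `ΣΣ w·F`, `ΣΣ w·A(𝐚₁;ρ,ψ)A(𝐚₂;1−ρ,ψ̄)` |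
| `Detector.Positive` | `Skeleton.Lemma23` | the weight is real and `≥ 0` at every sampled pair, for all large `D` |
| `Kernel`, `Detector.theta` | `Skeleton.frakcW·ω`, `Skeleton.Theta1` | an integral kernel on a segment `𝔍(z)` and `Θ = Σ_ψ (1/2πi)∫ 𝔎·A·A` |
| `Detector.Lemma81` | `Skeleton.Lemma81` | discrete mean `=` `Θ_𝔎(𝐚₁,𝐚₂) + conj Θ_{𝔎′}(𝐚̄₂,𝐚̄₁) + o(𝔓)` |
| `Detector.Prop71` | `Skeleton.Prop71` | `Θ_𝔎 = M(𝐚₁,𝐚₂)·𝔓 + O(E) + o(𝔓)` with `M`, `E` NAMED functionals |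
| `Detector.MeanEval` | `Skeleton.Eval823` (pattern) | `ΣΣ w·F·conj G = m·𝔞𝔓 + o(𝔓)` for named test functions and a named constant `m` |

and PROVES that the template instantiates to the printed nodes: `zhang c′` (the manuscript's
detector) has `idx_zhang` (`= Skeleton.idx`, `rfl`), `pairMean_zhang` (`= Skeleton.lhs81`),
`theta_zhang` (`= Skeleton.Theta1`), `lemma81_zhang_iff` (`Lemma81 ↔ Skeleton.Lemma81`),
`prop71_zhang_iff` (`Prop71 ↔ Skeleton.Prop71`), `positive_zhang` (`Skeleton.Lemma23 ∧
Skeleton.Prop22i ⇒ Positive`, using (2.15) "`ω` is positive for `σ = 1/2`",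
`SmoothWeight.omega_re_pos_of_re_eq_half`), and the generalised (2.16) `re_mean_normSq_nonneg`
(a `Positive`-type weight gives `Re ΣΣ w|F|² ≥ 0`) — elementary; no named fact is introduced.

Conventions. As in the skeleton: `ForAllLarge` is the standing quantifier "for all large `D` and
every real primitive `χ (mod D)`"; (A) is `AssumptionA D χ`; coefficient sequences are admissible in
the sense (7.2) (`Adm72 D B a`: `|a(n)| ≤ B`, `a(n) = 0` for `n ≥ PT⁻²`) and enter through
`Apoly`/`ApolyBar` (support `n < ⌈PT⁻²⌉`) — i.e. the template keeps §§3–17 "as typed" and varies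
ONLY the detector (charter LS-PROGRAMME §2 row B-det); an off-diagonal / detector main term that is
not in print enters as a NAMED PARAMETER (`M`, `E`, `m`), never as "the true main term"
(OBJECTIVE.md §3.1; LEVERS §2 `EStarLen δ O` pattern). The profile-level main-term FORM of a
detector (`FormDet`, definition request D-det-1) is a separate file; a design's E(d) row plugs its
value into the slot `m` of `MeanEval` / `M` of `Prop71`.

v2 additions (same cell, rows AD-03/AD-05/AD-06 of `B-det/EDLIST-acting.md`):
* `ShiftData k` (shift sizes `b_j` and first-order corrections `e_j`, `β_j = i b_j α(1 + e_j c′α𝓛)`;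
  printed `b = (1,2,3)`, `e = (−5,1,−1)`, (2.13)), the general shift weight `cstarS S c′` =
  `−i Π_j M(ρ+β_j)/M′(ρ)` and the detector `shiftDetector S c′` (family `Ψ₁`, zeros `𝔷(ψ)`, weight
  `𝔠*_S ω`); PROVED `beta_zhangShift_{0,1,2}` (= `β₁, β₂, β₃`), `cstarS_zhang` (= `𝔠*`),
  `shiftDetector_zhang` (= `zhang c′`). The sign lemma of such a design is the predicate
  `(shiftDetector S c′).Positive` (for `S = zhangShift` it is `positive_zhang`).
* `Detector.MeanEval2 Δ F G m m₂ η` — the TWO-TERM (A)-conditional asymptotic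
  `ΣΣ w F Ḡ = (m + η(D)·m₂)·𝔞𝔓 + o(η(D)·𝔓)` with an EXPLICIT rate `η` and a NAMED second coefficient
  `m₂` (registry E-011 "E*-2nd"; nothing of this shape is in print — a predicate ON a design, never
  asserted; for a Cauchy–Schwarz endgame it is inert by `Det.not_mainOrder_closing`).
* the BRIDGE to D-det-1 (`DetectorMainTermForm.lean`): on real weights the `Δ`-weighted mean of
  `u·conj v` IS `Det.discreteForm (Δ.idx χ) (Re w) u v` (`mean_eq_discreteForm`), whence exact
  Cauchy–Schwarz (B1) for EVERY positively weighted skeleton detector (`norm_sq_mean_le`,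
  `Detector.Positive.cauchySchwarz`) by `Det.norm_sq_discreteForm_le` — the (O4) decision of
  OBJECTIVE.md §1.3: a detector with weights `≥ 0` and the CS endgame never closes on the nose.

v3 additions: FAITHFULNESS of the complex formulation — on real weights the mean of `|F|²` is the
printed real-part mean (`mean_normSq_eq_ofReal`), for the manuscript's detector the mean of `|H₁|²` is
`Ξ₁₁` (`mean_zhang_H1_eq_xi11`, realness from `real_zhang` = Lemma 2.3 ∧ Prop 2.2 (i)) and the
E-det-main node with `(H₁, H₁, 𝔠₁)` is EQUIVALENT to the skeleton's (8.23) (`meanEval_zhang_H1_iff`);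
and the two endgame bound nodes `Detector.MeanLower Δ Φ c` (gen. Prop. 2.4; `meanLower_zhang_iff`:
with `Φ* = H₁J̄₁ + H̄₂J₂`, `c = 5` it IS `Skeleton.Prop24`) and `Detector.MeanUpper Δ Φ c` (gen.
Prop. 2.5 / (2.32)–(2.33)); v4: `meanUpper_zhang_phiStar2_iff` (↔ `Skeleton.Prop25`),
`meanUpper_zhang_phiXi1_iff` (↔ `Skeleton.Ineq232`), `meanUpper_zhang_phiXiJ_iff` (↔ `Skeleton.Ineq233`)
given Lemma 2.3 ∧ Prop 2.2 (i) — every printed §2 endgame node now has a PROVED template twin.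

## References

* Y. Zhang, arXiv:2211.02515v1 (2022), §2 (2.13)–(2.20), Lemma 2.3; §7 (7.1)–(7.2), Prop. 7.1;
  §8 Lemma 8.1, (8.23). [cite: Zhang2022LandauSiegel, §§2, 7, 8]
-/

noncomputable section

open Complex Real ComplexConjugate

namespace Literature.NumberTheory.LFunctions.Zhang2022.DetTemplate

open Skeleton

/-! ## The detector datum -/

/-- **A zero-detector design on the skeleton** (the data that (2.16)–(2.20) fix once and for all in
the manuscript): for each modulus `D` and real primitive `χ (mod D)`,
* `fam D χ ⊆ Ψ` — the sub-family of characters summed over (printed: `Ψ₁`, §3 p. 7);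
* `pts D χ ψ ⊆ ℂ` — the sampled points of `ψ` (printed: `𝔷(ψ)`, the zeros (2.14) of `L(s,ψ)`);
* `wt D χ ψ ρ ∈ ℂ` — the weight of a sampled pair (printed: `𝔠*(ρ,ψ)ω(ρ)`, §2 p. 5, (2.15)).
[cite: Zhang2022LandauSiegel, §2 (2.14)–(2.16)] -/
structure Detector where
  /-- the sub-family of `Ψ` summed over (printed `Ψ₁`) -/
  fam : (D : ℕ) → [NeZero D] → DirichletCharacter ℂ D → Set (Chr D)
  /-- the sampled points of `ψ` (printed `𝔷(ψ)`, (2.14)) -/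
  pts : (D : ℕ) → [NeZero D] → DirichletCharacter ℂ D → Chr D → Set ℂ
  /-- the weight of a sampled pair `(ψ, ρ)` (printed `𝔠*(ρ,ψ)ω(ρ)`) -/
  wt : (D : ℕ) → [NeZero D] → DirichletCharacter ℂ D → Chr D → ℂ → ℂ

/-- **The manuscript's detector**: `Ψ₁`, the zeros `𝔷(ψ)` of (2.14), and the weight
`𝔠*(ρ,ψ)ω(ρ)` (with the "(large) constant" `c′` of (2.13) as parameter).
[cite: Zhang2022LandauSiegel, §2 (2.14)–(2.16)] -/
def zhang (c' : ℝ) : Detector where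
  fam := fun _ _ χ => PsiOne χ
  pts := fun D _ _ x => zeroSet D x
  wt := fun D _ _ x ρ => cstar c' D x ρ * omegaW D ρ

namespace Detector

variable (Δ : Detector) {D : ℕ} [NeZero D] (χ : DirichletCharacter ℂ D)

/-- The index set of the double sum `Σ_{ψ ∈ fam} Σ_{ρ ∈ pts ψ}`, as a `Finset` of pairs `(ψ, ρ)`
(junk value `∅` on an infinite component, as in `Skeleton.idx`).
[cite: Zhang2022LandauSiegel, §2 (2.16)] -/
def idx : Finset ((_ : Chr D) × ℂ) :=
  (finsetOf (Δ.fam D χ)).sigma fun x => finsetOf (Δ.pts D χ x)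

/-- **The `Δ`-weighted discrete mean of a test function `F(ψ,ρ)`**: `Σ_{(ψ,ρ)} w(ψ,ρ)·F(ψ,ρ)`
(printed, for `w = 𝔠*ω` and `F = |𝔥|²`: the left side of (2.16)).
[cite: Zhang2022LandauSiegel, §2 (2.16)] -/
def mean (F : Chr D → ℂ → ℂ) : ℂ := ∑ i ∈ Δ.idx χ, Δ.wt D χ i.1 i.2 * F i.1 i.2

/-- **The `Δ`-weighted bilinear discrete mean of two coefficient sequences** (7.2):
`Σ_{(ψ,ρ)} w(ψ,ρ)·A(𝐚₁;ρ,ψ)·A(𝐚₂;1−ρ,ψ̄)` — for `Δ = zhang c′` the left side of Lemma 8.1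
(`pairMean_zhang`). [cite: Zhang2022LandauSiegel, §8 Lemma 8.1] -/
def pairMean (a₁ a₂ : ℕ → ℂ) : ℂ :=
  Δ.mean χ fun x ρ => Apoly x a₁ ρ * ApolyBar x a₂ (1 - ρ)

end Detector

/-- **Generalised Lemma 2.3 (the sign lemma a detector must supply for (2.16))**: for all large `D`,
at every sampled pair the weight is real and non-negative. For `Δ = zhang c′` this follows from the
manuscript's Lemma 2.3 and Prop. 2.2 (i) (`positive_zhang`). A predicate ON the design `Δ` —
stated, never asserted. [cite: Zhang2022LandauSiegel, §2 Lemma 2.3] -/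
def Detector.Positive (Δ : Detector) : Prop :=
  ForAllLarge fun D _ χ => ∀ x ∈ Δ.fam D χ, ∀ ρ ∈ Δ.pts D χ x,
    (Δ.wt D χ x ρ).im = 0 ∧ 0 ≤ (Δ.wt D χ x ρ).re

/-! ## The integral side: kernels, `Θ`, and the generalised Lemma 8.1 / Proposition 7.1 -/

/-- **An integral kernel recipe**: the segment abscissa `z` (the segment
`𝔍(z) = [s₀ + z − i𝓛₁, s₀ + z + i𝓛₁]`, §7 p. 13; printed `z = 1`) and the integrand factor
`𝔎(s,ψ)` multiplying `A(𝐚₁;s,ψ)A(𝐚₂;1−s,ψ̄)` (printed: `𝔠(s,ψ)ω(s)`, (7.1), (2.15)).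
[cite: Zhang2022LandauSiegel, §7 (7.1), Prop. 7.1] -/
structure Kernel where
  /-- the abscissa of the segment `𝔍(z)` (printed `1`) -/
  z : ℝ
  /-- the integrand factor `𝔎(s,ψ)` (printed `𝔠(s,ψ)ω(s)`) -/
  ker : (D : ℕ) → [NeZero D] → DirichletCharacter ℂ D → Chr D → ℂ → ℂ

/-- **The manuscript's kernel**: `z = 1`, `𝔎(s,ψ) = 𝔠(s,ψ)ω(s)` with `𝔠` of (7.1).
[cite: Zhang2022LandauSiegel, §7 (7.1), Prop. 7.1] -/
def zhangKernel (c' : ℝ) : Kernel where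
  z := 1
  ker := fun D _ _ x s => frakcW c' x s * omegaW D s

/-- **A main-term functional** `M(𝐚₁,𝐚₂)` (printed: `α⁻¹(½S₁ + 2S₂ + 3/2S₃)`, Prop. 7.1) — the
slot a design's NAMED main term fills. [cite: Zhang2022LandauSiegel, §7 Prop. 7.1] -/
abbrev MainTerm := (D : ℕ) → [NeZero D] → DirichletCharacter ℂ D → (ℕ → ℂ) → (ℕ → ℂ) → ℂ

/-- **An error functional** `E(𝐚₁,𝐚₂)` (printed: `E(𝐚₁,𝐚₂) = 𝔓𝓛²Σ_j|S_j|`, Prop. 7.1).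
[cite: Zhang2022LandauSiegel, §7 Prop. 7.1] -/
abbrev ErrorTerm := (D : ℕ) → [NeZero D] → DirichletCharacter ℂ D → (ℕ → ℂ) → (ℕ → ℂ) → ℝ

/-- The manuscript's main-term functional `α⁻¹(½S₁ + 2S₂ + 3/2S₃)` (so that
`M·𝔓 = Skeleton.mainMV`). [cite: Zhang2022LandauSiegel, §7 Prop. 7.1] -/
def zhangMain (c' : ℝ) : MainTerm := fun D _ _ a₁ a₂ =>
  (alpha D : ℂ)⁻¹ * (1 / 2 * Sj c' D 1 a₁ a₂ + 2 * Sj c' D 2 a₁ a₂ + 3 / 2 * Sj c' D 3 a₁ a₂)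

/-- The manuscript's error functional `E(𝐚₁,𝐚₂)` (`Skeleton.Ecal`).
[cite: Zhang2022LandauSiegel, §7 Prop. 7.1] -/
def zhangErr (c' : ℝ) : ErrorTerm := fun D _ _ a₁ a₂ => Ecal c' D a₁ a₂

namespace Detector

variable (Δ : Detector) (K : Kernel) {D : ℕ} [NeZero D] (χ : DirichletCharacter ℂ D)

/-- **`Θ_𝔎(𝐚₁,𝐚₂) = Σ_{ψ ∈ fam} (1/2πi)∫_{𝔍(z)} 𝔎(s,ψ)A(𝐚₁;s,ψ)A(𝐚₂;1−s,ψ̄) ds`** — for the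
manuscript's detector and kernel this is `Θ₁(𝐚₁,𝐚₂)` of Proposition 7.1 (`theta_zhang`).
[cite: Zhang2022LandauSiegel, §7 Prop. 7.1] -/
def theta (a₁ a₂ : ℕ → ℂ) : ℂ :=
  ∑ x ∈ finsetOf (Δ.fam D χ), Lemma81.segInt (t0 D) (ell1 D) K.z fun s =>
    K.ker D χ x s * (Apoly x a₁ s * ApolyBar x a₂ (1 - s))

/-- **Generalised Lemma 8.1 (the residue step of a detector)**: for `𝐚₁, 𝐚₂` admissible in the
sense (7.2), under (A), `ΣΣ w·A(𝐚₁;ρ,ψ)A(𝐚₂;1−ρ,ψ̄) = Θ_𝔎(𝐚₁,𝐚₂) + conj Θ_{𝔎′}(𝐚̄₂,𝐚̄₁) + o(𝔓)`,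
with a right-moving kernel `𝔎` and a reflected kernel `𝔎′` (printed: `𝔎 = 𝔎′ = 𝔠ω`, by the
reflection `−Ĩ₁⁻(𝐚₁,𝐚₂;ψ) = conj Ĩ₁⁺(𝐚̄₂,𝐚̄₁;ψ)`). For the manuscript's detector this IS
`Skeleton.Lemma81` (`lemma81_zhang_iff`). A predicate ON the design — stated, never asserted.
[cite: Zhang2022LandauSiegel, §8 Lemma 8.1] -/
def Lemma81 (Δ : Detector) (K K' : Kernel) : Prop :=
  ∀ B : ℝ, ∀ ε : ℝ, 0 < ε → ForAllLarge fun D _ χ => AssumptionA D χ →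
    ∀ a₁ a₂ : ℕ → ℂ, Adm72 D B a₁ → Adm72 D B a₂ →
      ‖Δ.pairMean χ a₁ a₂ -
          (Δ.theta K χ a₁ a₂ +
            conj (Δ.theta K' χ (fun n => conj (a₂ n)) (fun n => conj (a₁ n))))‖
        ≤ ε * frakP D

/-- **Generalised Proposition 7.1 (the mean-value formula of a detector's kernel)**: for `𝐚₁, 𝐚₂`
admissible in the sense (7.2), under (A), `Θ_𝔎(𝐚₁,𝐚₂) = M(𝐚₁,𝐚₂)·𝔓 + O(E(𝐚₁,𝐚₂)) + o(𝔓)` with a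
NAMED main-term functional `M` and error functional `E` (the implied constant may depend on the
bound `B` of (7.2)). For the manuscript's kernel, `M = α⁻¹(½S₁ + 2S₂ + 3/2S₃)` and `E = 𝓔`, this IS
`Skeleton.Prop71` (`prop71_zhang_iff`). A predicate ON the design — stated, never asserted.
[cite: Zhang2022LandauSiegel, §7 Prop. 7.1] -/
def Prop71 (Δ : Detector) (K : Kernel) (M : MainTerm) (E : ErrorTerm) : Prop :=
  ∀ B : ℝ, ∀ ε : ℝ, 0 < ε → ∃ C : ℝ, ForAllLarge fun D _ χ => AssumptionA D χ →
    ∀ a₁ a₂ : ℕ → ℂ, Adm72 D B a₁ → Adm72 D B a₂ →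
      ‖Δ.theta K χ a₁ a₂ - M D χ a₁ a₂ * frakP D‖ ≤ C * E D χ a₁ a₂ + ε * frakP D

end Detector

/-! ## The evaluation node a design's E(d) row cites: `ΣΣ w·F·conj G = m·𝔞𝔓 + o(𝔓)` -/

/-- **A test-function recipe** `F(s,ψ)` (printed: `𝔥 = H₁ + Z(s,ψχ)H̄₂`, `J₁`, … of §2).
[cite: Zhang2022LandauSiegel, §2 (2.16)–(2.17)] -/
abbrev TestFun := (D : ℕ) → [NeZero D] → DirichletCharacter ℂ D → Chr D → ℂ → ℂ

namespace Detector

/-- **The (A)-conditional evaluation of a `Δ`-weighted discrete mean** (the E-det-main pattern):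
for named test functions `F, G` and a named constant `m ∈ ℂ`,
`Σ_{(ψ,ρ)} w(ψ,ρ)F(ρ,ψ)conj G(ρ,ψ) = m·𝔞𝔓 + o(𝔓)`, typed as "for every `ε > 0`, for all large `D`,
under (A), `|ΣΣ w F Ḡ − m𝔞𝔓| ≤ ε𝔓`" — the shape of the manuscript's (8.23)
`Ξ₁₁ = 𝔠₁𝔞𝔓 + o(𝔓)` (`Skeleton.Eval823`, where `w = 𝔠*ω`, `F = G = H₁`, `m = 𝔠₁`). The constant `m`
is the slot a design's profile-level main-term form fills; `frakA χ = 𝔞` is (2.31). A predicate ON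
the design — stated, never asserted. [cite: Zhang2022LandauSiegel, §8 (8.23)] -/
def MeanEval (Δ : Detector) (F G : TestFun) (m : ℂ) : Prop :=
  ∀ ε : ℝ, 0 < ε → ForAllLarge fun D _ χ => AssumptionA D χ →
    ‖Δ.mean χ (fun x ρ => F D χ x ρ * conj (G D χ x ρ)) - m * frakA χ * frakP D‖ ≤ ε * frakP D

end Detector

/-! ## The template instantiates to the printed nodes -/

section Zhang

variable (c' : ℝ) {D : ℕ} [NeZero D] (χ : DirichletCharacter ℂ D)

/-- The index set of `zhang c′` is the skeleton's `idx χ` (pairs `(ψ, ρ)`, `ψ ∈ Ψ₁`, `ρ ∈ 𝔷(ψ)`).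
[cite: Zhang2022LandauSiegel, §2 (2.16)] -/
theorem idx_zhang : (zhang c').idx χ = Skeleton.idx χ := rfl

/-- The bilinear discrete mean of `zhang c′` is the left side of Lemma 8.1, `Skeleton.lhs81`.
[cite: Zhang2022LandauSiegel, §8 Lemma 8.1] -/
theorem pairMean_zhang (a₁ a₂ : ℕ → ℂ) :
    (zhang c').pairMean χ a₁ a₂ = lhs81 c' χ a₁ a₂ := by
  unfold Detector.pairMean Detector.mean lhs81
  rw [idx_zhang]
  refine Finset.sum_congr rfl fun i _ => ?_
  simp only [zhang]
  ring

/-- `Θ` of `zhang c′` with the kernel `𝔠ω` on `𝔍(1)` is `Θ₁` of Proposition 7.1, `Skeleton.Theta1`.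
[cite: Zhang2022LandauSiegel, §7 Prop. 7.1] -/
theorem theta_zhang (a₁ a₂ : ℕ → ℂ) :
    (zhang c').theta (zhangKernel c') χ a₁ a₂ = Theta1 c' χ a₁ a₂ := by
  unfold Detector.theta Theta1
  refine Finset.sum_congr rfl fun x _ => ?_
  simp only [zhangKernel]
  congr 1
  funext s
  ring

/-- **The template's Lemma 8.1 for the manuscript's detector is the skeleton's Lemma 8.1.**
[cite: Zhang2022LandauSiegel, §8 Lemma 8.1] -/
theorem lemma81_zhang_iff :
    (zhang c').Lemma81 (zhangKernel c') (zhangKernel c') ↔ Skeleton.Lemma81 c' := by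
  simp only [Detector.Lemma81, Skeleton.Lemma81, pairMean_zhang, theta_zhang]

/-- **The template's Proposition 7.1 for the manuscript's kernel is the skeleton's Prop. 7.1.**
[cite: Zhang2022LandauSiegel, §7 Prop. 7.1] -/
theorem prop71_zhang_iff :
    (zhang c').Prop71 (zhangKernel c') (zhangMain c') (zhangErr c') ↔ Skeleton.Prop71 c' := by
  simp only [Detector.Prop71, Skeleton.Prop71, theta_zhang, zhangMain, zhangErr, mainMV]

/-- A sampled zero `ρ ∈ 𝔷(ψ)` lies in `Ω` and is a zero of `L(s,ψ)L(s,ψχ)`: the box (2.14) is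
"slightly smaller than `Ω`" (2.7). [cite: Zhang2022LandauSiegel, §2 (2.7), (2.14)] -/
theorem mem_prodZeroSetOmega_of_mem_zeroSet (x : Chr D) {ρ : ℂ} (hρ : ρ ∈ zeroSet D x) :
    ρ ∈ prodZeroSetOmega χ x := by
  obtain ⟨hre, him, hL⟩ := hρ
  refine ⟨?_, by rw [hL, zero_mul]⟩
  refine ⟨?_, ?_⟩
  · have h : (ρ - s0 D).re = ρ.re - 1 / 2 := by
      simp [Skeleton.s0, SmoothWeight.s0_def]
    rw [h]; exact hre
  · have h : (ρ - s0 D).im = ρ.im - 2 * π * t0 D := by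
      simp [Skeleton.s0, SmoothWeight.s0_def]
    rw [h]; linarith

/-- `𝓛₂ = 𝓛⁴⁰⁰ > 0` once `D ≥ 2`. [cite: Zhang2022LandauSiegel, §2 (2.15)] -/
theorem ell2_pos {D : ℕ} (hD : 2 ≤ D) : 0 < ell2 D := by
  have h : 0 < ell D := Real.log_pos (by exact_mod_cast hD)
  simp only [ell2]
  positivity

/-- **The manuscript's detector is `Positive` given its Lemma 2.3 and Prop. 2.2 (i)**: `𝔠*(ρ,ψ)` is
real and `≥ 0` (Lemma 2.3), the sampled zeros are on the critical line (Prop. 2.2 (i); `𝔷(ψ) ⊆ Ω`),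
and "`ω` is positive for `σ = 1/2`" ((2.15), `SmoothWeight.omega_re_pos_of_re_eq_half`), so
`𝔠*(ρ,ψ)ω(ρ)` is real and `≥ 0`. (Kernel check that `Detector.Positive` is the printed (2.16) input.)
[cite: Zhang2022LandauSiegel, §2 Lemma 2.3, (2.15)–(2.16)] -/
theorem positive_zhang (h23 : Skeleton.Lemma23 c') (h22 : Skeleton.Prop22i) :
    (zhang c').Positive := by
  have h2 : ForAllLarge fun D _ _ => 0 < ell2 D :=
    ForAllLarge.of_le 2 fun D _ _ hD _ _ => ell2_pos hD
  refine ((h23.and h22).and h2).mono ?_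
  intro D _ χ _ _ h x hx ρ hρ
  obtain ⟨⟨hL23, hP22⟩, hℓ2⟩ := h
  obtain ⟨him, hre⟩ := hL23 x hx ρ hρ
  have hline : ρ.re = 1 / 2 := hP22 x hx ρ (mem_prodZeroSetOmega_of_mem_zeroSet χ x hρ)
  obtain ⟨hωre, hωim⟩ := SmoothWeight.omega_re_pos_of_re_eq_half hℓ2 (t0 D) hline
  simp only [zhang, Skeleton.omegaW]
  refine ⟨?_, ?_⟩
  · rw [Complex.mul_im, him, hωim]; ring
  · rw [Complex.mul_re, him, hωim, mul_zero, sub_zero]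
    exact mul_nonneg hre hωre.le

end Zhang

/-! ## The generalised (2.16): a `Positive`-type weight gives a non-negative mean square -/

section Positivity

variable (Δ : Detector) {D : ℕ} [NeZero D] (χ : DirichletCharacter ℂ D)

/-- **Generalised (2.16)**: if at every pair of the index set the weight is real and `≥ 0` (the
conclusion of `Detector.Positive` at this `D, χ`), then for every test function `F`,
`Re Σ_{(ψ,ρ)} w(ψ,ρ)|F(ψ,ρ)|² ≥ 0` and the sum is real — "Lemma 2.3 implies (2.16) for all
functions `𝔥`". [cite: Zhang2022LandauSiegel, §2 (2.16)] -/
theorem re_mean_normSq_nonneg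
    (hw : ∀ i ∈ Δ.idx χ, (Δ.wt D χ i.1 i.2).im = 0 ∧ 0 ≤ (Δ.wt D χ i.1 i.2).re)
    (F : Chr D → ℂ → ℂ) :
    0 ≤ (Δ.mean χ fun x ρ => F x ρ * conj (F x ρ)).re ∧
      (Δ.mean χ fun x ρ => F x ρ * conj (F x ρ)).im = 0 := by
  unfold Detector.mean
  rw [Complex.re_sum, Complex.im_sum]
  refine ⟨Finset.sum_nonneg fun i hi => ?_, Finset.sum_eq_zero fun i hi => ?_⟩
  · obtain ⟨him, hre⟩ := hw i hi
    dsimp only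
    rw [Complex.mul_conj, Complex.mul_re, him, zero_mul, sub_zero, Complex.ofReal_re]
    exact mul_nonneg hre (Complex.normSq_nonneg _)
  · obtain ⟨him, hre⟩ := hw i hi
    dsimp only
    rw [Complex.mul_conj, Complex.mul_im, him, zero_mul, Complex.ofReal_im, mul_zero, add_zero]

/-- The pointwise hypothesis of `re_mean_normSq_nonneg` is what `Detector.Positive` delivers at each
large `D` (membership in `idx` is membership in `fam`/`pts`, the finsets of finite sets; on an
infinite component `idx` is empty and the hypothesis is vacuous). [cite: Zhang2022LandauSiegel, §2 (2.16)] -/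
theorem wt_real_nonneg_of_mem_idx
    (h : ∀ x ∈ Δ.fam D χ, ∀ ρ ∈ Δ.pts D χ x, (Δ.wt D χ x ρ).im = 0 ∧ 0 ≤ (Δ.wt D χ x ρ).re)
    (i : (_ : Chr D) × ℂ) (hi : i ∈ Δ.idx χ) :
    (Δ.wt D χ i.1 i.2).im = 0 ∧ 0 ≤ (Δ.wt D χ i.1 i.2).re := by
  obtain ⟨hx, hρ⟩ := Finset.mem_sigma.mp hi
  exact h i.1 (mem_of_mem_finsetOf hx) i.2 (mem_of_mem_finsetOf hρ)

/-- **(2.16) for a `Positive` detector, in the standing quantifier**: for all large `D`, every real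
primitive `χ` and every test function `F`, the `Δ`-weighted mean square is a non-negative real.
[cite: Zhang2022LandauSiegel, §2 (2.16)] -/
theorem Detector.Positive.ineq216 {Δ : Detector} (h : Δ.Positive) :
    ForAllLarge fun D _ χ => ∀ F : Chr D → ℂ → ℂ,
      0 ≤ (Δ.mean χ fun x ρ => F x ρ * conj (F x ρ)).re ∧
        (Δ.mean χ fun x ρ => F x ρ * conj (F x ρ)).im = 0 :=
  h.mono fun _ _ χ _ _ hD F => re_mean_normSq_nonneg Δ χ (wt_real_nonneg_of_mem_idx Δ χ hD) F

end Positivity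

/-! ## v2 · Shift-set detectors `𝔠*_S` (registry E-010 / LEVERS L8; acting row AD-03) -/

section Shift

/-- **Shift data of a `k`-shift detector**: sizes `b_j` and first-order corrections `e_j`, the shifts
being `β_j = i b_j α (1 + e_j c′ α 𝓛)` — printed (2.13): `b = (1, 2, 3)`, `e = (−5, 1, −1)`
(`β₁ = iα(1 − 5c′α𝓛)`, `β₂ = 2iα(1 + c′α𝓛)`, `β₃ = 3iα(1 − c′α𝓛)`).
[cite: Zhang2022LandauSiegel, §2 (2.13)] -/
structure ShiftData (k : ℕ) where
  /-- shift sizes `b_j` (in units of `iα`) -/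
  b : Fin k → ℝ
  /-- first-order corrections `e_j` (in units of `c′α𝓛`) -/
  e : Fin k → ℝ

/-- The manuscript's shift data: `b = (1,2,3)`, `e = (−5,1,−1)` (2.13).
[cite: Zhang2022LandauSiegel, §2 (2.13)] -/
def zhangShift : ShiftData 3 := ⟨![1, 2, 3], ![-5, 1, -1]⟩

namespace ShiftData

variable {k : ℕ} (S : ShiftData k) (c' : ℝ) (D : ℕ)

/-- **`β_j = i b_j α (1 + e_j c′ α 𝓛)`** (the shape of (2.13)). [cite: Zhang2022LandauSiegel, §2 (2.13)] -/
def beta (j : Fin k) : ℂ :=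
  I * (S.b j : ℂ) * (alpha D : ℂ) * ((1 + S.e j * c' * alpha D * ell D : ℝ) : ℂ)

end ShiftData

/-- `β` of the manuscript's shift data, channel `0`, is `β₁` of (2.13). [cite: Zhang2022LandauSiegel, §2 (2.13)] -/
theorem beta_zhangShift_zero (c' : ℝ) (D : ℕ) : zhangShift.beta c' D 0 = beta1 c' D := by
  simp only [ShiftData.beta, zhangShift, beta1, Matrix.cons_val_zero]
  push_cast
  ring

/-- `β` of the manuscript's shift data, channel `1`, is `β₂` of (2.13). [cite: Zhang2022LandauSiegel, §2 (2.13)] -/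
theorem beta_zhangShift_one (c' : ℝ) (D : ℕ) : zhangShift.beta c' D 1 = beta2 c' D := by
  simp only [ShiftData.beta, zhangShift, beta2, Matrix.cons_val_one, Matrix.cons_val_zero]
  push_cast
  ring

/-- `β` of the manuscript's shift data, channel `2`, is `β₃` of (2.13). [cite: Zhang2022LandauSiegel, §2 (2.13)] -/
theorem beta_zhangShift_two (c' : ℝ) (D : ℕ) : zhangShift.beta c' D 2 = beta3 c' D := by
  have h2 : (![1, 2, 3] : Fin 3 → ℝ) 2 = 3 := rfl
  have h2' : (![-5, 1, -1] : Fin 3 → ℝ) 2 = -1 := rfl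
  simp only [ShiftData.beta, zhangShift, beta3, h2, h2']
  push_cast
  ring

variable {k : ℕ}

/-- **The shift weight `𝔠*_S(ρ,ψ) = −i Π_j M(ρ+β_j,ψ) / M′(ρ,ψ)`** of a `k`-shift detector (printed for
`S = {β₁,β₂,β₃}`: `𝔠*(ρ,ψ)`, §2 p. 5; general admissible `S`: the "sieve dimension" lever, whose
sign lemma is the grouping rule read off the proof of Lemma 2.3). [cite: Zhang2022LandauSiegel, §2 p. 5, Lemma 2.3] -/
def cstarS (S : ShiftData k) (c' : ℝ) (D : ℕ) (x : Chr D) (ρ : ℂ) : ℂ :=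
  -I * (∏ j, Mfun x.ψ (ρ + S.beta c' D j)) / deriv (Mfun x.ψ) ρ

/-- **The `k`-shift detector**: family `Ψ₁`, sampled points `𝔷(ψ)` (2.14), weight `𝔠*_S(ρ,ψ)ω(ρ)`.
Its sign lemma is the predicate `(shiftDetector S c′).Positive`; its E-det-main rows are
`(shiftDetector S c′).MeanEval …` with the constant slot filled by `Det.FormDet (Det.shiftRecipe b)`.
[cite: Zhang2022LandauSiegel, §2 (2.14)–(2.16), Lemma 2.3] -/
def shiftDetector (S : ShiftData k) (c' : ℝ) : Detector where
  fam := fun _ _ χ => PsiOne χ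
  pts := fun D _ _ x => zeroSet D x
  wt := fun D _ _ x ρ => cstarS S c' D x ρ * omegaW D ρ

/-- **The manuscript's detector is the shift detector of `zhangShift`**: `𝔠*_S = 𝔠*` for `S = (2.13)`.
[cite: Zhang2022LandauSiegel, §2 p. 5] -/
theorem cstarS_zhang (c' : ℝ) (D : ℕ) (x : Chr D) (ρ : ℂ) :
    cstarS zhangShift c' D x ρ = cstar c' D x ρ := by
  unfold cstarS cstar
  rw [Fin.prod_univ_three, beta_zhangShift_zero, beta_zhangShift_one, beta_zhangShift_two]
  ring

/-- `shiftDetector zhangShift c′ = zhang c′`. [cite: Zhang2022LandauSiegel, §2 (2.14)–(2.16)] -/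
theorem shiftDetector_zhang (c' : ℝ) : shiftDetector zhangShift c' = zhang c' := by
  unfold shiftDetector zhang
  congr 1
  funext D _ χ x ρ
  rw [cstarS_zhang]

end Shift

/-! ## v2 · The two-term node E*-2nd (registry E-011; acting row AD-05) -/

/-- **The TWO-TERM (A)-conditional evaluation of a `Δ`-weighted discrete mean** (registry E-011,
"E*-2nd"): for named test functions `F, G`, named constants `m, m₂ ∈ ℂ` and an EXPLICIT rate
`η : ℕ → ℝ` (e.g. `𝓛⁻¹`, `α𝓛`), `Σ_{(ψ,ρ)} w F conj G = (m + η(D)·m₂)·𝔞𝔓 + o(η(D)·𝔓)`, typed as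
"for every `ε > 0`, for all large `D`, under (A), `|ΣΣ w F Ḡ − (m + η m₂)𝔞𝔓| ≤ ε·η(D)·𝔓`". Nothing
of this shape is in print for the manuscript's means (its evaluations (8.23), (9.7), (18.1) are
one-term); a predicate ON the design — stated, never asserted. For a Cauchy–Schwarz endgame a
second-order term is inert at main order (`Det.not_mainOrder_closing`).
[cite: Zhang2022LandauSiegel, §8 (8.23)] -/
def Detector.MeanEval2 (Δ : Detector) (F G : TestFun) (m m₂ : ℂ) (η : ℕ → ℝ) : Prop :=
  ∀ ε : ℝ, 0 < ε → ForAllLarge fun D _ χ => AssumptionA D χ →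
    ‖Δ.mean χ (fun x ρ => F D χ x ρ * conj (G D χ x ρ)) - (m + η D * m₂) * frakA χ * frakP D‖
      ≤ ε * η D * frakP D

/-! ## v2 · Bridge to D-det-1: the skeleton mean IS `Det.discreteForm`; exact CS for every positive detector -/

section Bridge

variable (Δ : Detector) {D : ℕ} [NeZero D] (χ : DirichletCharacter ℂ D)

/-- **Bridge.** On real weights (the conclusion of `Detector.Positive`, first half) the `Δ`-weighted
mean of `u·conj v` is D-det-1's discrete form `Ξ_w(u,v)` (`Det.discreteForm`) on the index finset
`Δ.idx χ` with `w = Re wt`. [cite: Zhang2022LandauSiegel, §2 (2.16)–(2.17)] -/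
theorem mean_eq_discreteForm (hw : ∀ i ∈ Δ.idx χ, (Δ.wt D χ i.1 i.2).im = 0)
    (u v : (_ : Chr D) × ℂ → ℂ) :
    (Δ.mean χ fun x ρ => u ⟨x, ρ⟩ * conj (v ⟨x, ρ⟩)) =
      Det.discreteForm (Δ.idx χ) (fun i => (Δ.wt D χ i.1 i.2).re) u v := by
  unfold Detector.mean Det.discreteForm
  refine Finset.sum_congr rfl fun i hi => ?_
  have hz : Δ.wt D χ i.1 i.2 = ((Δ.wt D χ i.1 i.2).re : ℂ) :=
    Complex.ext (by simp) (by simp [hw i hi])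
  rw [hz]

/-- **Exact Cauchy–Schwarz (B1) for every skeleton detector with real non-negative weights**
(D-det-1's `Det.norm_sq_discreteForm_le` through the bridge): `‖ΣΣ w u v̄‖² ≤ (ΣΣ w|u|²)(ΣΣ w|v|²)`.
[cite: Zhang2022LandauSiegel, §2 (2.18)–(2.19), (2.32)–(2.33)] -/
theorem norm_sq_mean_le
    (hw : ∀ i ∈ Δ.idx χ, (Δ.wt D χ i.1 i.2).im = 0 ∧ 0 ≤ (Δ.wt D χ i.1 i.2).re)
    (u v : (_ : Chr D) × ℂ → ℂ) :
    ‖Δ.mean χ fun x ρ => u ⟨x, ρ⟩ * conj (v ⟨x, ρ⟩)‖ ^ 2 ≤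
      (Δ.mean χ fun x ρ => u ⟨x, ρ⟩ * conj (u ⟨x, ρ⟩)).re *
        (Δ.mean χ fun x ρ => v ⟨x, ρ⟩ * conj (v ⟨x, ρ⟩)).re := by
  have hre : ∀ i ∈ Δ.idx χ, (Δ.wt D χ i.1 i.2).im = 0 := fun i hi => (hw i hi).1
  rw [mean_eq_discreteForm Δ χ hre u v, mean_eq_discreteForm Δ χ hre u u,
    mean_eq_discreteForm Δ χ hre v v]
  exact Det.norm_sq_discreteForm_le (fun i hi => (hw i hi).2) u v

/-- **The (O4) decision for positively weighted detectors with the Cauchy–Schwarz endgame**: for a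
`Positive` detector, for all large `D` and every pair of test families `u, v` on the sampled pairs,
`‖ΣΣ w u v̄‖² ≤ (ΣΣ w|u|²)·(ΣΣ w|v|²)` EXACTLY — so its three discrete means can never satisfy the
closing inequality `(ΣΣw|u|²)(ΣΣw|v|²) < ‖ΣΣ w u v̄‖²` (LEVERS §0.6 (B1); OBJECTIVE.md §1.3 (O4):
"a detector with `𝔠*_S ≥ 0` and the CS endgame is inside `R̄`"). [cite: Zhang2022LandauSiegel, §2 (2.16)–(2.19)] -/
theorem Detector.Positive.cauchySchwarz {Δ : Detector} (h : Δ.Positive) :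
    ForAllLarge fun D _ χ => ∀ u v : (_ : Chr D) × ℂ → ℂ,
      ¬ ((Δ.mean χ fun x ρ => u ⟨x, ρ⟩ * conj (u ⟨x, ρ⟩)).re *
            (Δ.mean χ fun x ρ => v ⟨x, ρ⟩ * conj (v ⟨x, ρ⟩)).re <
          ‖Δ.mean χ fun x ρ => u ⟨x, ρ⟩ * conj (v ⟨x, ρ⟩)‖ ^ 2) :=
  h.mono fun _ _ χ _ _ hD u v =>
    not_lt.mpr (norm_sq_mean_le Δ χ (wt_real_nonneg_of_mem_idx Δ χ hD) u v)

end Bridge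

/-! ## v3 · Faithfulness of the complex formulation: on real weights `MeanEval` is the printed real-part mean -/

section Faithful

variable (Δ : Detector) {D : ℕ} [NeZero D] (χ : DirichletCharacter ℂ D)

/-- On real weights the complex mean of `|F|²` is the real number `Σ Re w · ‖F‖²` — the shape in which
the manuscript writes its mean squares (`Skeleton.xi11`, `xi12`, `xiJ`: `ΣΣ Re 𝔠* · |·|² · Re ω`).
[cite: Zhang2022LandauSiegel, §2 (2.16), (2.32)–(2.33)] -/
theorem mean_normSq_eq_ofReal (hw : ∀ i ∈ Δ.idx χ, (Δ.wt D χ i.1 i.2).im = 0)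
    (F : Chr D → ℂ → ℂ) :
    (Δ.mean χ fun x ρ => F x ρ * conj (F x ρ)) =
      ((∑ i ∈ Δ.idx χ, (Δ.wt D χ i.1 i.2).re * ‖F i.1 i.2‖ ^ 2 : ℝ) : ℂ) := by
  unfold Detector.mean
  push_cast
  refine Finset.sum_congr rfl fun i hi => ?_
  have hz : Δ.wt D χ i.1 i.2 = ((Δ.wt D χ i.1 i.2).re : ℂ) :=
    Complex.ext (by simp) (by simp [hw i hi])
  rw [hz, Complex.mul_conj']
  simp only [Complex.ofReal_re]

/-- **For the manuscript's detector, under the realness of `𝔠*` (Lemma 2.3) and of `ω` on the line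
(Prop. 2.2 (i), (2.15)) at the sampled pairs, the complex mean of `|H₁|²` IS `Ξ₁₁`** (`Skeleton.xi11`,
(8.3)). [cite: Zhang2022LandauSiegel, §8 (8.3)] -/
theorem mean_zhang_H1_eq_xi11 (c' : ℝ)
    (hre : ∀ x ∈ PsiOne χ, ∀ ρ ∈ zeroSet D x, (cstar c' D x ρ).im = 0 ∧ (omegaW D ρ).im = 0) :
    ((zhang c').mean χ fun x ρ => H1 χ x ρ * conj (H1 χ x ρ)) = (xi11 c' χ : ℂ) := by
  unfold Detector.mean xi11
  rw [idx_zhang]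
  push_cast
  refine Finset.sum_congr rfl fun i hi => ?_
  obtain ⟨hx, hρ⟩ := Finset.mem_sigma.mp hi
  obtain ⟨hc, hω⟩ := hre i.1 (mem_of_mem_finsetOf hx) i.2 (mem_of_mem_finsetOf hρ)
  have hc' : cstar c' D i.1 i.2 = ((cstar c' D i.1 i.2).re : ℂ) := Complex.ext (by simp) (by simp [hc])
  have hω' : omegaW D i.2 = ((omegaW D i.2).re : ℂ) := Complex.ext (by simp) (by simp [hω])
  simp only [zhang]
  rw [hc', hω', Complex.mul_conj']
  simp only [Complex.ofReal_re]
  ring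

/-- The realness inputs of `mean_zhang_H1_eq_xi11`, for all large `D`, from the manuscript's Lemma 2.3
and Prop. 2.2 (i) (with (2.15): `ω` is real on the critical line).
[cite: Zhang2022LandauSiegel, §2 Lemma 2.3, Prop. 2.2 (i), (2.15)] -/
theorem real_zhang (c' : ℝ) (h23 : Skeleton.Lemma23 c') (h22 : Skeleton.Prop22i) :
    ForAllLarge fun D _ χ => ∀ x ∈ PsiOne χ, ∀ ρ ∈ zeroSet D x,
      (cstar c' D x ρ).im = 0 ∧ (omegaW D ρ).im = 0 := by
  have h2 : ForAllLarge fun D _ _ => 0 < ell2 D :=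
    ForAllLarge.of_le 2 fun D _ _ hD _ _ => ell2_pos hD
  refine ((h23.and h22).and h2).mono ?_
  intro D _ χ _ _ h x hx ρ hρ
  obtain ⟨⟨hL23, hP22⟩, hℓ2⟩ := h
  refine ⟨(hL23 x hx ρ hρ).1, ?_⟩
  have hline : ρ.re = 1 / 2 := hP22 x hx ρ (mem_prodZeroSetOmega_of_mem_zeroSet χ x hρ)
  exact (SmoothWeight.omega_re_pos_of_re_eq_half hℓ2 (t0 D) hline).2

/-- **Faithfulness check on the printed node (8.23).** Given the manuscript's Lemma 2.3 and Prop. 2.2 (i),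
the template's E-det-main node for the manuscript's detector with test function `H₁` and constant
`𝔠₁` IS the skeleton's `Eval823` ("`Ξ₁₁ = 𝔠₁𝔞𝔓 + o(𝔓)`"). [cite: Zhang2022LandauSiegel, §8 (8.23)] -/
theorem meanEval_zhang_H1_iff (c' : ℝ) (h23 : Skeleton.Lemma23 c') (h22 : Skeleton.Prop22i) :
    (zhang c').MeanEval (fun _ _ χ x s => H1 χ x s) (fun _ _ χ x s => H1 χ x s) (frakc1.re : ℂ) ↔
      Skeleton.Eval823 c' := by
  have hR := real_zhang c' h23 h22
  have key : ∀ (D : ℕ) [NeZero D] (χ : DirichletCharacter ℂ D),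
      (∀ x ∈ PsiOne χ, ∀ ρ ∈ zeroSet D x, (cstar c' D x ρ).im = 0 ∧ (omegaW D ρ).im = 0) →
        ‖((zhang c').mean χ fun x ρ => H1 χ x ρ * conj (H1 χ x ρ)) -
            (frakc1.re : ℂ) * frakA χ * frakP D‖ =
          |xi11 c' χ - frakc1.re * frakA χ * frakP D| := by
    intro D _ χ hre
    rw [mean_zhang_H1_eq_xi11 χ c' hre]
    norm_cast
  constructor
  · intro hM ε hε
    refine ((hM ε hε).and hR).mono ?_
    intro D _ χ _ _ h hA
    obtain ⟨h1, h2⟩ := h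
    rw [← key D χ h2]
    exact h1 hA
  · intro hE ε hε
    refine ((hE ε hε).and hR).mono ?_
    intro D _ χ _ _ h hA
    obtain ⟨h1, h2⟩ := h
    rw [key D χ h2]
    exact h1 hA

end Faithful

/-! ## v3 · The endgame bound nodes: Prop 2.4 / Prop 2.5 / (2.32)–(2.33) shapes with the detector as parameter -/

/-- **A test-expression recipe** `Φ(ψ,ρ)` — a general sesquilinear expression in the design's
polynomials (printed, Prop. 2.4: `Φ = H₁J̄₁ + H̄₂J₂`; (2.32): `Φ = |H₁ + Z(ρ,ψχ)H̄₂|²`).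
[cite: Zhang2022LandauSiegel, §2 (2.17), (2.32)] -/
abbrev TestExpr := (D : ℕ) → [NeZero D] → DirichletCharacter ℂ D → Chr D → ℂ → ℂ

/-- **Generalised Proposition 2.4 (the LOWER bound of an endgame)**: under (A), for all large `D`,
`c·𝔞𝔓 < |Σ_{(ψ,ρ)} w(ψ,ρ)·Φ(ψ,ρ)|`. For the manuscript's detector with `Φ = H₁J̄₁ + H̄₂J₂`, `c = 5`
this IS `Skeleton.Prop24` (`meanLower_zhang_iff`). A predicate ON the design — stated, never asserted.
[cite: Zhang2022LandauSiegel, §2 Prop. 2.4] -/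
def Detector.MeanLower (Δ : Detector) (Φ : TestExpr) (c : ℝ) : Prop :=
  ForAllLarge fun D _ χ => AssumptionA D χ → c * frakA χ * frakP D < ‖Δ.mean χ (Φ D χ)‖

/-- **Generalised Proposition 2.5 / (2.32) / (2.33) (the UPPER bounds of an endgame)**: under (A), for
all large `D`, `Re Σ_{(ψ,ρ)} w(ψ,ρ)·Φ(ψ,ρ) < c·𝔞𝔓` (printed: `Ξ₁ < 0.001𝔞𝔓`, `Ξ_J < 3000𝔞𝔓`,
`Ξ₂* < 2𝔞𝔓`, each the real-part mean of a non-negative expression). A predicate ON the design —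
stated, never asserted. [cite: Zhang2022LandauSiegel, §2 Prop. 2.5, (2.32)–(2.33)] -/
def Detector.MeanUpper (Δ : Detector) (Φ : TestExpr) (c : ℝ) : Prop :=
  ForAllLarge fun D _ χ => AssumptionA D χ → (Δ.mean χ (Φ D χ)).re < c * frakA χ * frakP D

/-- The printed test expression of `Ξ₁*` (2.17): `Φ*(ψ,ρ) = H₁(ρ,ψ)J̄₁(ρ,ψ) + H̄₂(ρ,ψ)J₂(ρ,ψ)`.
[cite: Zhang2022LandauSiegel, §2 (2.17)] -/
def phiStar1 : TestExpr := fun _ _ χ x ρ =>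
  H1 χ x ρ * conj (J1 χ x ρ) + conj (H2 χ x ρ) * J2 χ x ρ

/-- The `zhang c′`-mean of `Φ*` is `Ξ₁*` (2.17) — no realness hypothesis needed (both are the complex
sums `ΣΣ 𝔠*·Φ*·ω`). [cite: Zhang2022LandauSiegel, §2 (2.17)] -/
theorem mean_zhang_phiStar1 (c' : ℝ) {D : ℕ} [NeZero D] (χ : DirichletCharacter ℂ D) :
    (zhang c').mean χ (phiStar1 D χ) = xiStar1 c' χ := by
  unfold Detector.mean xiStar1 phiStar1
  rw [idx_zhang]
  refine Finset.sum_congr rfl fun i _ => ?_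
  simp only [zhang]
  ring

/-- **The template's lower-bound node for the manuscript's detector, `Φ*` and `c = 5` IS Prop. 2.4.**
[cite: Zhang2022LandauSiegel, §2 Prop. 2.4] -/
theorem meanLower_zhang_iff (c' : ℝ) : (zhang c').MeanLower phiStar1 5 ↔ Skeleton.Prop24 c' := by
  simp only [Detector.MeanLower, Skeleton.Prop24, mean_zhang_phiStar1]

/-! ## v4 · Faithfulness of the upper-bound node: Prop 2.5, (2.32), (2.33) are `MeanUpper` instances -/

section UpperFaithful

variable (c' : ℝ) {D : ℕ} [NeZero D] (χ : DirichletCharacter ℂ D)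

/-- For the manuscript's detector and a test expression with REAL values at the sampled pairs,
under realness of `𝔠*` and `ω` there, the real part of the complex mean is the printed real-part sum
`ΣΣ Re 𝔠*·Φ·Re ω`. [cite: Zhang2022LandauSiegel, §2 (2.16), (2.32)–(2.33)] -/
theorem re_mean_zhang_of_real (Φ : Chr D → ℂ → ℂ)
    (hre : ∀ x ∈ PsiOne χ, ∀ ρ ∈ zeroSet D x, (cstar c' D x ρ).im = 0 ∧ (omegaW D ρ).im = 0)
    (hΦ : ∀ x ∈ PsiOne χ, ∀ ρ ∈ zeroSet D x, (Φ x ρ).im = 0) :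
    ((zhang c').mean χ Φ).re =
      ∑ i ∈ idx χ, (cstar c' D i.1 i.2).re * (Φ i.1 i.2).re * (omegaW D i.2).re := by
  unfold Detector.mean
  rw [idx_zhang, Complex.re_sum]
  refine Finset.sum_congr rfl fun i hi => ?_
  obtain ⟨hx, hρ⟩ := Finset.mem_sigma.mp hi
  have hx' := mem_of_mem_finsetOf hx
  have hρ' := mem_of_mem_finsetOf hρ
  obtain ⟨hc, hω⟩ := hre i.1 hx' i.2 hρ'
  have hφ := hΦ i.1 hx' i.2 hρ'
  simp only [zhang, Complex.mul_re, Complex.mul_im, hc, hω, hφ, mul_zero, zero_mul, sub_zero,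
    add_zero]
  ring

/-- The printed test expression of `Ξ₂*` (Prop. 2.5): `Φ₂(ψ,ρ) = |H₁ + Z(ρ,χψ)H̄₂|·|J₁|` (real).
[cite: Zhang2022LandauSiegel, §2 (2.19), Prop. 2.5] -/
def phiStar2 : TestExpr := fun _ _ χ x ρ =>
  ((‖H1 χ x ρ + Zpc χ x ρ * conj (H2 χ x ρ)‖ * ‖J1 χ x ρ‖ : ℝ) : ℂ)

/-- The printed test expression of `Ξ₁` ((2.32)): `Φ₁(ψ,ρ) = |H₁ + Z(ρ,χψ)H̄₂|²` (real).
[cite: Zhang2022LandauSiegel, §2 (2.32)] -/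
def phiXi1 : TestExpr := fun _ _ χ x ρ => ((‖H1 χ x ρ + Zpc χ x ρ * conj (H2 χ x ρ)‖ ^ 2 : ℝ) : ℂ)

/-- The printed test expression of `Ξ_J` ((2.33)): `Φ_J(ψ,ρ) = |J₁|²` (real).
[cite: Zhang2022LandauSiegel, §2 (2.33)] -/
def phiXiJ : TestExpr := fun _ _ χ x ρ => ((‖J1 χ x ρ‖ ^ 2 : ℝ) : ℂ)

/-- `Re` of the `zhang c′`-mean of `Φ₂` is `Ξ₂*` under realness. [cite: Zhang2022LandauSiegel, §2 Prop. 2.5] -/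
theorem re_mean_zhang_phiStar2
    (hre : ∀ x ∈ PsiOne χ, ∀ ρ ∈ zeroSet D x, (cstar c' D x ρ).im = 0 ∧ (omegaW D ρ).im = 0) :
    ((zhang c').mean χ (phiStar2 D χ)).re = xiStar2 c' χ := by
  rw [re_mean_zhang_of_real c' χ (phiStar2 D χ) hre (fun _ _ _ _ => Complex.ofReal_im _)]
  unfold xiStar2 phiStar2
  simp only [Complex.ofReal_re]

/-- `Re` of the `zhang c′`-mean of `Φ₁` is `Ξ₁` under realness. [cite: Zhang2022LandauSiegel, §2 (2.32)] -/
theorem re_mean_zhang_phiXi1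
    (hre : ∀ x ∈ PsiOne χ, ∀ ρ ∈ zeroSet D x, (cstar c' D x ρ).im = 0 ∧ (omegaW D ρ).im = 0) :
    ((zhang c').mean χ (phiXi1 D χ)).re = xi1 c' χ := by
  rw [re_mean_zhang_of_real c' χ (phiXi1 D χ) hre (fun _ _ _ _ => Complex.ofReal_im _)]
  unfold xi1 phiXi1
  simp only [Complex.ofReal_re]

/-- `Re` of the `zhang c′`-mean of `Φ_J` is `Ξ_J` under realness. [cite: Zhang2022LandauSiegel, §2 (2.33)] -/
theorem re_mean_zhang_phiXiJ
    (hre : ∀ x ∈ PsiOne χ, ∀ ρ ∈ zeroSet D x, (cstar c' D x ρ).im = 0 ∧ (omegaW D ρ).im = 0) :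
    ((zhang c').mean χ (phiXiJ D χ)).re = xiJ c' χ := by
  rw [re_mean_zhang_of_real c' χ (phiXiJ D χ) hre (fun _ _ _ _ => Complex.ofReal_im _)]
  unfold xiJ phiXiJ
  simp only [Complex.ofReal_re]

/-- ForAllLarge plumbing: two `ForAllLarge` predicates that agree pointwise on a third, eventually
true, property are equivalent. [folklore] -/
private theorem forAllLarge_congr_of
    {P Q R : (D : ℕ) → [NeZero D] → DirichletCharacter ℂ D → Prop} (hR : ForAllLarge R)
    (h : ∀ (D : ℕ) [NeZero D] (χ : DirichletCharacter ℂ D), R D χ → (P D χ ↔ Q D χ)) :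
    ForAllLarge P ↔ ForAllLarge Q := by
  constructor
  · intro hP
    exact (hP.and hR).mono fun D _ χ _ _ hh => (h D χ hh.2).mp hh.1
  · intro hQ
    exact (hQ.and hR).mono fun D _ χ _ _ hh => (h D χ hh.2).mpr hh.1

/-- **`(zhang c′).MeanUpper Φ₂ 2 ↔ Prop. 2.5`** given Lemma 2.3 and Prop. 2.2 (i).
[cite: Zhang2022LandauSiegel, §2 Prop. 2.5] -/
theorem meanUpper_zhang_phiStar2_iff (h23 : Skeleton.Lemma23 c') (h22 : Skeleton.Prop22i) :
    (zhang c').MeanUpper phiStar2 2 ↔ Skeleton.Prop25 c' := by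
  refine forAllLarge_congr_of (real_zhang c' h23 h22) fun D _ χ hre => ?_
  simp only [re_mean_zhang_phiStar2 c' χ hre]

/-- **`(zhang c′).MeanUpper Φ₁ 0.001 ↔ (2.32)`** given Lemma 2.3 and Prop. 2.2 (i).
[cite: Zhang2022LandauSiegel, §2 (2.32)] -/
theorem meanUpper_zhang_phiXi1_iff (h23 : Skeleton.Lemma23 c') (h22 : Skeleton.Prop22i) :
    (zhang c').MeanUpper phiXi1 0.001 ↔ Skeleton.Ineq232 c' := by
  refine forAllLarge_congr_of (real_zhang c' h23 h22) fun D _ χ hre => ?_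
  simp only [re_mean_zhang_phiXi1 c' χ hre]

/-- **`(zhang c′).MeanUpper Φ_J 3000 ↔ (2.33)`** given Lemma 2.3 and Prop. 2.2 (i).
[cite: Zhang2022LandauSiegel, §2 (2.33)] -/
theorem meanUpper_zhang_phiXiJ_iff (h23 : Skeleton.Lemma23 c') (h22 : Skeleton.Prop22i) :
    (zhang c').MeanUpper phiXiJ 3000 ↔ Skeleton.Ineq233 c' := by
  refine forAllLarge_congr_of (real_zhang c' h23 h22) fun D _ χ hre => ?_
  simp only [re_mean_zhang_phiXiJ c' χ hre]

end UpperFaithful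

end Literature.NumberTheory.LFunctions.Zhang2022.DetTemplate
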